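import Summits.BirchSwinnertonDyer.BirchSwinnertonDyer.Theorems.GenusKolyvaginAtTwoGenusPrimitiveSupplyAtTwoLoweringPrime
import Summits.BirchSwinnertonDyer.BirchSwinnertonDyer.Theorems.GenusKolyvaginAtTwoGenusPrimitiveSupplyAtTwoTwistSelmerTransferDownTwo
import Summits.BirchSwinnertonDyer.BirchSwinnertonDyer.Theorems.GenusKolyvaginAtTwoGenusPrimitiveSupplyAtTwoTwistRamifiedTransversalRat
import Summits.BirchSwinnertonDyer.BirchSwinnertonDyer.Theorems.GenusKolyvaginAtTwoGenusPrimitiveSupplyAtTwoTwistSelmerTransferDownRat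
import Literature.NumberTheory.EllipticCurves.PAdicGrossZagierConstantTermProofs
import Literature.NumberTheory.EllipticCurves.SelmerCorankControlRatProofs
import Literature.NumberTheory.EllipticCurves.CasselsTateSelmerKolyvaginValue
import Literature.NumberTheory.QuadraticForms.PadicHilbertSymbol
import Literature.NumberTheory.QuadraticForms.PadicSquares
import HarnessLib

/-!
# Route `GenusKolyvaginAtTwo`, crux #2 `GenusPrimitiveSupplyAtTwo` (stmt-BirchSwinnertonDyer-22136):
# MAZUR–RUBIN 2010 PROP. 5.2 AT `p = 2` KERNEL-PROVED for `ρ̄_{E,2}` onto — «a prime twist `E^{(p)}`, `p ≡ 1 (mod m)`,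
# lowers the `2`-Selmer rank by TWO» — modulo the two standard duality facts {Poitou–Tate (real places), Tate χ}

Lead seat `bsd-line-gk2-p1` g8 (cell `bsd-f1-sign2`). THEOREMS ONLY (no definition, no named fact, no `sorry`); helper
`--supports stmt-BirchSwinnertonDyer-22136`; no item is closed; BSD is not proved by any of this.

WHY. The crux's twin SUPPLY (stub A, `GenusKolyTwin.minimalSelmerTwinSupply_of_lowering`, gk2-p5 g0 p591445) is proved
from Modularity, `2`-parity, Cassels–Tate and the binder `hMR` = `MazurRubin2010.prop52_rat` (named PRINT fact = Mazur–Rubin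
2010 Prop. 5.2 over `ℚ` in its proof form). This file PROVES that proposition for curves with `ρ̄_{E,2}` onto (the crux's
habitat; every twist of such a curve is again such a curve) and globally minimal models (no loss: `Sel₂` is model-invariant),
granted only `poitouTate_selmerStructure_duality_real ℚ` and `localEulerPoincareCharacteristic` — the two standard print
facts already displayed by every X11b / gk2-p5 / lead transfer theorem:

* §1 local inputs over `ℚ`: an integer `≡ 1 (mod 8)` is a square in `ℚ_v` for `v ∣ 2`, an integer `≡ 1 (mod q)` is a
  square in `ℚ_v` for `v ∣ q` odd (Hensel; tree `padic_isSquare_intCast_of_mod_eight`, `padicInt_isSquare_of_toZMod_eq_one`,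
  transported along Mathlib's `padicEquiv`), a positive rational is a square in `ℚ_∞` (Mathlib `ringEquivRealOfIsReal`).
* §2 **`exists_prime_card_selmerGroup_quadraticTwist_mul_four_eq`** — `W/ℚ` globally minimal, `ρ̄_{W,2}` onto, two
  distinct non-zero classes `x, y ∈ Sel₂(W)`, `m ≥ 1` ⟹ a prime `p ≡ 1 (mod m)` of good reduction with
  `#Sel₂(W^{(p)}) · 4 = #Sel₂(W)`. Assembly: the split twisting prime of `…LoweringPrime` (`exists_splitTwistingPrime_pair`,
  Čebotarev proved) with modulus `8 · m · ∏_{q bad} q` and the bad places + the place of `2` excluded; the place menu of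
  `…TwistSelmerTransferDownTwo.natCard_selmerGroup_twist_mul_four_eq_of_places` is then discharged row by row (2 and the bad
  primes SPLIT in `ℚ(√p)` since `p ≡ 1 (mod 8q)`; `∞` splits since `p > 0`; good odd `q ≠ p`: both curves good by the tree's
  `hasGoodReductionAt_quadraticTwist`; at `p`: `W` good, `v_p(p) = 1`).
* §3 **`prop52_of_hasSurjectiveModNGaloisRep`** — the statement of `MazurRubin2010.prop52_rat` with `E(ℚ)[2] = 0` strengthened
  to «`ρ̄_{E,2}` onto» and `E` globally minimal: `#Sel₂(W) = 2^s`, `s > 1`, `m ≠ 0` ⟹ `∃ p ≡ 1 (mod m)` prime with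
  `#Sel₂(W^{(p)}) = 2^{s−2}`. (The `C₃` case of the printed proposition — `E(ℚ)[2] = 0` with `Δ ∈ ℚ^{×2}` — is not treated:
  gk2-p4's image algebra `h1_restriction_injective_two_rat` / dichotomy is typed for `ρ̄₂` onto; the crux never meets it.)

Companion (next file): stub A's twin SUPPLY re-issued with `hMR ↦ {PT, Tate χ}`.

References: [MazurRubin2010] B. Mazur, K. Rubin, Invent. Math. 181 (2010) = arXiv:0904.3709: Prop. 5.2 and its proof (p. 12),
Lemma 3.6 (p. 9), Cor. 3.4 (i) (p. 9), Lemmas 2.10–2.11 (pp. 6–7); [Serre1973] Ch. II §3.3 Thm. 3–4 (squares in `ℚ_p`);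
[SilvermanAEC2009] VII.5 Prop. 5.1, X.§4; [MilneADT2006] I Thm. 2.8, Thm. 4.10.
-/

set_option linter.dupNamespace false -- tree convention: `Summit.BirchSwinnertonDyer.BirchSwinnertonDyer.Theorems` (summit = sub-problem)
set_option autoImplicit false

noncomputable section

open scoped Classical ContRepresentation

namespace Summit.BirchSwinnertonDyer.BirchSwinnertonDyer.Theorems.GenusKolyLowering

open WeierstrassCurve Field NumberField IsDedekindDomain Function
open Literature.NumberTheory.EllipticCurves Literature.NumberTheory.GaloisRepresentations
open Literature.NumberTheory.GaloisCohomology Literature.NumberTheory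
open Rat.HeightOneSpectrum
open Summit.BirchSwinnertonDyer.BirchSwinnertonDyer.Theorems.GenusKolyTwistingPrime (primesEquiv_eq natCast_not_mem_of_not_dvd)
open Summit.BirchSwinnertonDyer.BirchSwinnertonDyer.Theorems.GenusKolyTwistRamified
  (valuation_natCast_eq_exp_neg_one_of_mem exists_uniformizer_sq_mul_of_valuation_eq)

/-! ## §1 Local square inputs over `ℚ` -/

section LocalSquares

/-- **An integer `≡ 1 (mod 8)` is a square in `ℚ_v` at the place `v` of `2`** (Serre II.3.3 Thm. 4; tree
`padic_isSquare_intCast_of_mod_eight`, transported along Mathlib's `ℚ_v ≃ ℚ_2`). [cite: Serre1973, Ch. II §3.3 Thm. 4] -/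
theorem exists_sq_eq_adicCompletion_of_mod_eight (v : HeightOneSpectrum (𝓞 ℚ)) (h2v : ((2 : ℕ) : 𝓞 ℚ) ∈ v.asIdeal)
    {n : ℕ} (hn : (n : ℤ) % 8 = 1) :
    ∃ s : v.adicCompletion ℚ, s ^ 2 = algebraMap ℚ (v.adicCompletion ℚ) (n : ℚ) := by
  have hv2 : (primesEquiv v : ℕ) = 2 := primesEquiv_eq Nat.prime_two h2v
  haveI hF : Fact (primesEquiv v : ℕ).Prime := ⟨(primesEquiv v).2⟩
  obtain ⟨r, hr⟩ := QuadraticForms.padic_isSquare_intCast_of_mod_eight (p := (primesEquiv v : ℕ)) hv2 hn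
  set e : v.adicCompletion ℚ ≃+* ℚ_[(primesEquiv v : ℕ)] :=
    RingEquivClass.toRingEquiv (adicCompletion.padicEquiv (R := 𝓞 ℚ) v) with he
  refine ⟨e.symm r, ?_⟩
  rw [sq, ← map_mul, ← hr, map_intCast, map_natCast, Int.cast_natCast]

/-- **An integer `≡ 1 (mod q)`, `q` odd, is a square in `ℚ_v` at the place `v` of `q`** (Hensel, Serre II.3.3 Thm. 3;
tree `padicInt_isSquare_of_toZMod_eq_one`). [cite: Serre1973, Ch. II §3.3 Thm. 3] -/
theorem exists_sq_eq_adicCompletion_of_modEq_one (v : HeightOneSpectrum (𝓞 ℚ)) {q : ℕ} (hq : q.Prime) (hq2 : q ≠ 2)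
    (hqv : (q : 𝓞 ℚ) ∈ v.asIdeal) {n : ℕ} (hn : (n : ℤ) ≡ 1 [ZMOD (q : ℤ)]) :
    ∃ s : v.adicCompletion ℚ, s ^ 2 = algebraMap ℚ (v.adicCompletion ℚ) (n : ℚ) := by
  have hvq : (primesEquiv v : ℕ) = q := primesEquiv_eq hq hqv
  haveI hF : Fact (primesEquiv v : ℕ).Prime := ⟨(primesEquiv v).2⟩
  have hq2' : (primesEquiv v : ℕ) ≠ 2 := by rw [hvq]; exact hq2
  have h1 : PadicInt.toZMod ((n : ℕ) : ℤ_[(primesEquiv v : ℕ)]) = 1 := by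
    rw [map_natCast]
    have hn' : (n : ℤ) ≡ 1 [ZMOD ((primesEquiv v : ℕ) : ℤ)] := by rw [hvq]; exact hn
    have h := (ZMod.intCast_eq_intCast_iff (n : ℤ) 1 (primesEquiv v : ℕ)).mpr hn'
    rwa [Int.cast_natCast, Int.cast_one] at h
  obtain ⟨r, hr⟩ := QuadraticForms.padicInt_isSquare_of_toZMod_eq_one hq2' h1
  set e : v.adicCompletion ℚ ≃+* ℚ_[(primesEquiv v : ℕ)] :=
    RingEquivClass.toRingEquiv (adicCompletion.padicEquiv (R := 𝓞 ℚ) v) with he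
  refine ⟨e.symm (r : ℚ_[(primesEquiv v : ℕ)]), ?_⟩
  have hr' : ((n : ℕ) : ℚ_[(primesEquiv v : ℕ)]) = (r : ℚ_[(primesEquiv v : ℕ)]) * r := by
    rw [← PadicInt.coe_mul, ← hr]; simp
  rw [sq, ← map_mul, ← hr', map_natCast, map_natCast]

/-- **A positive integer is a square in `ℚ_∞ = ℝ`** (Mathlib `Completion.ringEquivRealOfIsReal`; `ℚ` is totally real).
[folklore] -/
theorem exists_sq_eq_infinitePlace_completion (w : InfinitePlace ℚ) (n : ℕ) :
    ∃ s : w.Completion, s ^ 2 = algebraMap ℚ w.Completion (n : ℚ) := by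
  have hw : w.IsReal := IsTotallyReal.isReal w
  set e : w.Completion ≃+* ℝ := InfinitePlace.Completion.ringEquivRealOfIsReal hw with he
  refine ⟨e.symm (Real.sqrt n), ?_⟩
  rw [sq, ← map_mul, Real.mul_self_sqrt (Nat.cast_nonneg n), map_natCast, map_natCast]

end LocalSquares

/-! ## §2 The lowering prime: `#Sel₂(W^{(p)}) · 4 = #Sel₂(W)` at a split twisting prime `p ≡ 1 (mod m)` -/

section Step

variable (W : WeierstrassCurve ℚ) [W.IsElliptic] [W.IsGloballyMinimal]

/-- **THE LOWERING STEP (Mazur–Rubin Prop. 5.2, Selmer form, `ρ̄₂` onto), modulo {PT, Tate χ}.** For `W/ℚ` globally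
minimal with `ρ̄_{W,2}` onto, two distinct non-zero classes `x, y ∈ Sel₂(W)` and `m ≥ 1`, there is a prime `p` with
`p ≡ 1 (mod m)`, `p ∤ 2m`, `W` good at `p`, and **`#Sel₂(W^{(p)}) · 4 = #Sel₂(W)`** for the model `W.quadraticTwist p`.
The prime is the split twisting prime of `exists_splitTwistingPrime_pair` for the modulus `8·m·∏_{q bad} q`, off the bad
places and the place of `2`; the Selmer count is `natCard_selmerGroup_twist_mul_four_eq_of_places` with its place menu
discharged (§1; good reduction of the twist away from `2p·Δ`: tree `hasGoodReductionAt_quadraticTwist`).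
[cite: MazurRubin2010, Prop. 5.2 and its proof (arXiv:0904.3709 p. 12), Cor. 3.4 (i), Lemma 3.6]
[cite: MilneADT2006, Ch. I, Thm. 4.10] [cite: SilvermanAEC2009, VII.5 Prop. 5.1(a)] -/
theorem exists_prime_card_selmerGroup_quadraticTwist_mul_four_eq
    (hPT : poitouTate_selmerStructure_duality_real ℚ)
    (hEP : ∀ v : HeightOneSpectrum (𝓞 ℚ), localEulerPoincareCharacteristic (v.adicCompletion ℚ))
    (hsurj : W.HasSurjectiveModNGaloisRep 2)
    {x y : galH1Torsion W (2 : ℤ)} (hxS : x ∈ W.selmerGroup 2) (hyS : y ∈ W.selmerGroup 2)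
    (hx : x ≠ 0) (hy : y ≠ 0) (hxy : x ≠ y) {m : ℕ} (hm : m ≠ 0) :
    ∃ p : ℕ, p.Prime ∧ (p : ℤ) ≡ 1 [ZMOD (m : ℤ)] ∧ ¬ p ∣ 2 * m ∧
      (∀ _h : Fact p.Prime, W.HasGoodReductionAtPrime p) ∧
      Nat.card ((W.quadraticTwist (p : ℚ)).selmerGroup 2) * 4 = Nat.card (W.selmerGroup 2) := by
  classical
  -- ### the finite set of bad places and the place of `2`
  have hbadfin : {v : HeightOneSpectrum (𝓞 ℚ) | ¬ W.HasGoodReductionAt v}.Finite := by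
    have h := W.eventually_hasGoodReductionAt
    rwa [Filter.eventually_cofinite] at h
  have h2fin : {v : HeightOneSpectrum (𝓞 ℚ) | ((2 : ℕ) : 𝓞 ℚ) ∈ v.asIdeal}.Finite :=
    Set.Subsingleton.finite fun v hv v' hv' ↦ HeightOneSpectrum.eq_of_natCast_mem_rat Nat.prime_two hv hv'
  set S' : Set (HeightOneSpectrum (𝓞 ℚ)) :=
    {v | ¬ W.HasGoodReductionAt v} ∪ {v | ((2 : ℕ) : 𝓞 ℚ) ∈ v.asIdeal} with hS'
  have hS'fin : S'.Finite := hbadfin.union h2fin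
  -- ### the modulus `8 · m · ∏_{q bad} q`
  set Bad : Finset ℕ := hbadfin.toFinset.image (fun v ↦ (primesEquiv v : ℕ)) with hBad
  set M : ℕ := ∏ q ∈ Bad, q with hM
  have hM0 : M ≠ 0 := Finset.prod_ne_zero_iff.mpr fun q hq ↦ by
    obtain ⟨v, -, rfl⟩ := Finset.mem_image.mp hq
    exact (primesEquiv v).2.ne_zero
  set m₀ : ℕ := 8 * m * M with hm₀
  have hm₀0 : m₀ ≠ 0 := mul_ne_zero (mul_ne_zero (by norm_num) hm) hM0
  -- ### the split twisting prime
  obtain ⟨p, hpF, -, hpm₀, hmod, v, 𝔓, t, hvS', hpv, -, -, -, -, -, -, -, -, hxloc, hyloc, hxyloc, hsubloc⟩ :=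
    exists_splitTwistingPrime_pair W hsurj hx hy hxy ⊤ (by simp) (fun _ _ ↦ Subgroup.mem_top _)
      hm₀0 ∅ hS'fin
  have hp : p.Prime := hpF.out
  have hgood : W.HasGoodReductionAt v := by
    by_contra h; exact hvS' (Or.inl h)
  have h2v : ((2 : ℕ) : 𝓞 ℚ) ∉ v.asIdeal := fun h ↦ hvS' (Or.inr h)
  have hp2 : p ≠ 2 := by rintro rfl; exact h2v hpv
  -- congruences extracted from `p ≡ 1 (mod 8 m M)`
  have hmod8 : (p : ℤ) % 8 = 1 := by
    have h := hmod.of_dvd (show ((8 : ℕ) : ℤ) ∣ (m₀ : ℤ) by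
      rw [hm₀]; exact_mod_cast (dvd_mul_right 8 m).mul_right M)
    have h' := Int.ModEq.eq h
    norm_num at h'
    omega
  have hmodm : (p : ℤ) ≡ 1 [ZMOD (m : ℤ)] :=
    hmod.of_dvd (by rw [hm₀]; exact_mod_cast (dvd_mul_left m 8).mul_right M)
  have hmodq : ∀ q ∈ Bad, (p : ℤ) ≡ 1 [ZMOD (q : ℤ)] := fun q hq ↦
    hmod.of_dvd (by rw [hm₀]; exact_mod_cast (Finset.dvd_prod_of_mem _ hq).mul_left (8 * m))
  have hpm : ¬ p ∣ 2 * m := fun h ↦ hpm₀ (by rw [hm₀, show 8 * m * M = 2 * m * (4 * M) by ring]; exact h.mul_right _)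
  -- ### the twist and its good reduction away from `2 p Δ`
  have hp0 : (p : ℚ) ≠ 0 := by exact_mod_cast hp.ne_zero
  haveI := W.isElliptic_quadraticTwist hp0
  have hΔ : ∀ (q : ℕ) [Fact q.Prime] (w : HeightOneSpectrum (𝓞 ℚ)), (q : 𝓞 ℚ) ∈ w.asIdeal →
      W.HasGoodReductionAt w → ¬ (q : ℤ) ∣ minimalDiscriminantInt W := fun q _ w hqw hw ↦
    W.not_dvd_minimalDiscriminantInt_of_hasGoodReductionAtPrime q
      (W.hasGoodReductionAtPrime_of_hasGoodReductionAt w hqw hw)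
  -- ### the Selmer count
  have hcount := natCard_selmerGroup_twist_mul_four_eq_of_places W hPT hEP hp0 (Wd := W.quadraticTwist (p : ℚ))
    (C := 1) (one_smul _ _) v h2v hgood
    (exists_uniformizer_sq_mul_of_valuation_eq v (valuation_natCast_eq_exp_neg_one_of_mem v hp hpv)) ?_ ?_ ?_
  · refine ⟨p, hp, hmodm, hpm, fun _ ↦ W.hasGoodReductionAtPrime_of_hasGoodReductionAt v hpv hgood, ?_⟩
    exact hcount
  · -- finite places `w ≠ v`
    intro w hw
    by_cases h2w : ((2 : ℕ) : 𝓞 ℚ) ∈ w.asIdeal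
    · exact Or.inl (exists_sq_eq_adicCompletion_of_mod_eight w h2w hmod8)
    by_cases hbad : W.HasGoodReductionAt w
    · -- good odd place `≠ v`: both curves good
      refine Or.inr (Or.inl ⟨h2w, hbad, ?_⟩)
      haveI hF : Fact (primesEquiv w : ℕ).Prime := ⟨(primesEquiv w).2⟩
      have hqw : ((primesEquiv w : ℕ) : 𝓞 ℚ) ∈ w.asIdeal := by
        have h := (natGenerator_dvd_iff (R := 𝓞 ℚ) w (n := (primesEquiv w : ℕ))).mp dvd_rfl
        rw [Ideal.mem_map_iff_of_surjective _ (Rat.IsIntegralClosure.intEquiv (𝓞 ℚ)).surjective] at h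
        obtain ⟨z, hz, hzq⟩ := h
        have : z = ((primesEquiv w : ℕ) : 𝓞 ℚ) :=
          (Rat.IsIntegralClosure.intEquiv (𝓞 ℚ)).injective (by rw [hzq, map_natCast])
        rwa [this] at hz
      have hq2 : (primesEquiv w : ℕ) ≠ 2 := fun h ↦ h2w (by rw [← h]; exact hqw)
      have hqp : (primesEquiv w : ℕ) ≠ p := fun h ↦ hw
        (HeightOneSpectrum.eq_of_natCast_mem_rat hp (by rw [← h]; exact hqw) hpv)
      have hpd : ¬ ((primesEquiv w : ℕ) : ℤ) ∣ 2 * (p : ℤ) := by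
        intro h
        have h' : (primesEquiv w : ℕ) ∣ 2 * p := by exact_mod_cast h
        rcases (Nat.Prime.dvd_mul hF.out).mp h' with h2 | hpp
        · exact hq2 ((Nat.prime_dvd_prime_iff_eq hF.out Nat.prime_two).mp h2)
        · exact hqp ((Nat.prime_dvd_prime_iff_eq hF.out hp).mp hpp)
      have h := W.hasGoodReductionAt_quadraticTwist w hpd (hΔ _ w hqw hbad)
      rwa [Int.cast_natCast] at h
    · -- bad place: `p ≡ 1 (mod q)` splits
      haveI hF : Fact (primesEquiv w : ℕ).Prime := ⟨(primesEquiv w).2⟩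
      have hqw : ((primesEquiv w : ℕ) : 𝓞 ℚ) ∈ w.asIdeal := by
        have h := (natGenerator_dvd_iff (R := 𝓞 ℚ) w (n := (primesEquiv w : ℕ))).mp dvd_rfl
        rw [Ideal.mem_map_iff_of_surjective _ (Rat.IsIntegralClosure.intEquiv (𝓞 ℚ)).surjective] at h
        obtain ⟨z, hz, hzq⟩ := h
        have : z = ((primesEquiv w : ℕ) : 𝓞 ℚ) :=
          (Rat.IsIntegralClosure.intEquiv (𝓞 ℚ)).injective (by rw [hzq, map_natCast])
        rwa [this] at hz
      have hq2 : (primesEquiv w : ℕ) ≠ 2 := fun h ↦ h2w (by rw [← h]; exact hqw)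
      have hqBad : (primesEquiv w : ℕ) ∈ Bad := Finset.mem_image.mpr ⟨w, hbadfin.mem_toFinset.mpr hbad, rfl⟩
      exact Or.inl (exists_sq_eq_adicCompletion_of_modEq_one w hF.out hq2 hqw (hmodq _ hqBad))
  · -- the infinite place splits (`p > 0`)
    exact fun w ↦ Or.inl (exists_sq_eq_infinitePlace_completion w p)
  · -- the two classes, in the Selmer-structure currency
    have hres : ∀ z : galH1Torsion W ((2 : ℕ) : ℤ), z ∉ W.torsionLocalKer (v.adicCompletion ℚ) ((2 : ℕ) : ℤ) →
        galoisCohomology.localization (W.torsionGaloisModule ((2 : ℕ) : ℤ)) (Sum.inr v) 1 z ≠ 0 := fun z hz h ↦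
      hz ((GenusKolyTwistLocal.mem_torsionLocalKer_iff_localization_eq_zero_rat W v z).mpr h)
    refine ⟨x, ?_, y, ?_, hres x hxloc, hres y hyloc, ?_, hres (x + y) hxyloc⟩
    · rw [← selmerGroup_eq_selmerGroup_kummerSelmerStructure]; exact hxS
    · rw [← selmerGroup_eq_selmerGroup_kummerSelmerStructure]; exact hyS
    · intro h
      exact hres (x - y) hsubloc
        ((map_sub (galoisCohomology.localization (W.torsionGaloisModule ((2 : ℕ) : ℤ)) (Sum.inr v) 1) x y).trans
          (sub_eq_zero.mpr h))

end Step

/-! ## §3 Prop. 5.2 for `ρ̄₂`-onto curves -/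

section Prop52

/-- A finite group of order `≥ 3` has two distinct non-zero elements. [folklore] -/
theorem exists_ne_ne_of_three_le_natCard {G : Type*} [AddGroup G] (H : AddSubgroup G) (h3 : 3 ≤ Nat.card H) :
    ∃ x ∈ H, ∃ y ∈ H, x ≠ 0 ∧ y ≠ 0 ∧ x ≠ y := by
  by_contra hcon
  push Not at hcon
  haveI : Finite H := Nat.finite_of_card_ne_zero (by omega)
  have hx : ∃ x ∈ H, x ≠ 0 := by
    by_contra h0
    push Not at h0
    have : H = ⊥ := (AddSubgroup.eq_bot_iff_forall _).mpr h0
    rw [this, AddSubgroup.card_bot] at h3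
    omega
  obtain ⟨x, hxH, hx0⟩ := hx
  let f : Bool → H := fun i ↦ if i then ⟨0, H.zero_mem⟩ else ⟨x, hxH⟩
  have hf : Function.Surjective f := fun z ↦ by
    by_cases hz : (z : G) = 0
    · exact ⟨true, Subtype.ext (by simp [f, hz])⟩
    · have : (z : G) = x := by
        by_contra hne
        exact hne ((hcon x hxH z z.2 hx0 hz).symm ▸ rfl)
      exact ⟨false, Subtype.ext (by simp [f, this])⟩
  have hle := Nat.card_le_card_of_surjective f hf
  have h2 : Nat.card Bool = 2 := by simp
  rw [h2] at hle
  omega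

/-- **MAZUR–RUBIN 2010, PROP. 5.2 AT `p = 2` — kernel theorem for `ρ̄_{E,2}` onto, modulo {PT, Tate χ}.** For `W/ℚ`
globally minimal elliptic with `ρ̄_{W,2} : Γ_ℚ → Aut E[2]` onto, `#Sel₂(W) = 2^s` with `s > 1`, and any modulus `m ≠ 0`:
there is a prime `p ≡ 1 (mod m)` with `#Sel₂(W^{(p)}) = 2^{s−2}` (model `W.quadraticTwist p`). Printed: «Suppose `E/K`
is an elliptic curve such that `E(K)[2] = 0`. If `d₂(E/K) > 1`, then `E` has a quadratic twist `E^F` over `K` such that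
`d₂(E^F/K) = d₂(E/K) − 2`», the proof giving `F = K(√π)`, `π ≡ 1 (mod 8Δ)` in any prescribed ray class. This is the
statement of the named fact `MazurRubin2010.prop52_rat` (binder `hMR` of stub A's twin SUPPLY) with `E(ℚ)[2] = 0`
strengthened to «`ρ̄₂` onto» (the crux's habitat; the `C₃` case is not treated) and `[W.IsGloballyMinimal]`, now a THEOREM
granted the two standard duality facts. [cite: MazurRubin2010, Prop. 5.2 and its proof (arXiv:0904.3709 p. 12) with Lemma 3.6 (p. 9)]
[cite: MilneADT2006, Ch. I, Thm. 4.10] -/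
theorem prop52_of_hasSurjectiveModNGaloisRep
    (hPT : poitouTate_selmerStructure_duality_real ℚ)
    (hEP : ∀ v : HeightOneSpectrum (𝓞 ℚ), localEulerPoincareCharacteristic (v.adicCompletion ℚ))
    (W : WeierstrassCurve ℚ) [W.IsElliptic] [W.IsGloballyMinimal] (hsurj : W.HasSurjectiveModNGaloisRep 2)
    (s : ℕ) (hSel : Nat.card (W.selmerGroup 2) = 2 ^ s) (hs : 1 < s) (m : ℕ) (hm : m ≠ 0) :
    ∃ p : ℕ, p.Prime ∧ (p : ℤ) ≡ 1 [ZMOD (m : ℤ)] ∧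
      Nat.card ((W.quadraticTwist (p : ℚ)).selmerGroup 2) = 2 ^ (s - 2) := by
  have h3 : 3 ≤ Nat.card (W.selmerGroup (2 : ℤ)) := by
    rw [hSel]
    calc 3 ≤ 2 ^ 2 := by norm_num
      _ ≤ 2 ^ s := Nat.pow_le_pow_right (by norm_num) hs
  obtain ⟨x, hxS, y, hyS, hx, hy, hxy⟩ := exists_ne_ne_of_three_le_natCard (W.selmerGroup (2 : ℤ)) h3
  obtain ⟨p, hp, hmod, -, -, hcount⟩ :=
    exists_prime_card_selmerGroup_quadraticTwist_mul_four_eq W hPT hEP hsurj hxS hyS hx hy hxy hm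
  refine ⟨p, hp, hmod, ?_⟩
  have hpow : 2 ^ s = 2 ^ (s - 2) * 4 := by
    have hs2 : 2 ≤ s := hs
    rw [show (4 : ℕ) = 2 ^ 2 by norm_num, ← pow_add, Nat.sub_add_cancel hs2]
  rw [hSel, hpow] at hcount
  exact Nat.eq_of_mul_eq_mul_right (by norm_num) hcount

end Prop52

end Summit.BirchSwinnertonDyer.BirchSwinnertonDyer.Theorems.GenusKolyLowering

end
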